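import Summits.BirchSwinnertonDyer.BirchSwinnertonDyer.Theorems.QuadraticBranchSignedControlPlusEtaNonsurjThetaFunctionalEquationZeroPairs
import Literature.NumberTheory.EllipticCurves.PadicSeriesEvaluation
import HarnessLib

/-!
# Route `QuadraticBranchSignedControl` (rung K8, cell `bsd-potss`), residual crux `PlusEtaMainConjectureNonsurj`
# (stmt-BirchSwinnertonDyer-19606): THE FUNCTIONAL EQUATION ON THE QUADRATIC BRANCH, XV — VALUES: `Λ = ℤ_p⟦T⟧` EVALUATED AT THE
# POINTS `T = t` OF THE OPEN DISC `pℤ_p`; `(ι L)(t) = L(t^ι)`; THE FACTOR THEOREM `(T − t) ∣ L ⟺ L(t) = 0`; and for EVERY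
# `L_p^±(V, η, X)`: `L(t^ι) = w·(1+t)^e·L(t)`, `‖L(t^ι)‖ = ‖L(t)‖`, `L(t) = 0 ⟺ L(t^ι) = 0` (seat `bsd-potss-k8eta-c2` g29; kernel, class-wide)

WHY. Parts IX–XIV (k8eta-c2 g28) proved the EXACT functional equation `ι L = w·(1+T)^e·L` of every branch function
`L = L_p^±(V, η, X)` (`IsQuadraticBranch{Plus,Minus}LFunction f p ϖ L`) as an identity in `Λ`, and Part XIII read it on LINEAR FACTORS:
`(T − c) ∣ L ⟺ (T − c^ι) ∣ L`. THIS FILE reads it on VALUES. The tree's evaluation homomorphisms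
`evalHom t ht : ℤ_p⟦T⟧ →+* ℤ_p` (`‖t‖ < 1`; `Literature/NumberTheory/EllipticCurves/PadicSeriesEvaluation.lean`, Mathlib's topological
evaluation into the linearly topologized complete ring `ℤ_p`) give every `L ∈ Λ` a value `L(t)` at each point `t` of the open disc, and
evaluation COMMUTES WITH SUBSTITUTION (tree `padicInt_eval₂_powerSeries_subst`), so for the Iwasawa involution `ι = subst((1+T)⁻¹ − 1)`:
**`(ι L)(t) = L(t^ι)`**, `t^ι = (1+t)⁻¹ − 1` (§30, `evalHom_invol`). Consequences: (§31) the FACTOR THEOREM in `Λ` —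
**`(T − t) ∣ L ⟺ L(t) = 0`** for `‖t‖ < 1` (explicit quotient series `Q = Σ_i T^i · (Σ_j a_{i+1+j} t^j)`, each coefficient a convergent
value; no Weierstrass preparation needed), so Part XIII's `ι`-pairs of linear factors ARE `ι`-pairs of `ℚ_p`-rational zeros; (§32) the
VALUE FORM of an exact functional equation: `ι L = w·(1+T)^e·L` gives **`L(t^ι) = w·(1+t)^e·L(t)`** with `(1+t)^e := ev_t (1+T)^e ∈ ℤ_pˣ`
(`(1+t)^e·(1+t)^{−e} = 1`), hence **`‖L(t^ι)‖ = ‖L(t)‖`** and `L(t) = 0 ⟺ L(t^ι) = 0`; (§33) ON THE QUADRATIC BRANCH, for EVERY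
`L_p^±(V, η, X)` and ANY period ratio: the explicit value relation (sign `σ·(−N | p)`, exponent `c + b` / `c + a`), the valuation symmetry
`‖L(t^ι)‖ = ‖L(t)‖` and the zero pairing with NO sign / exponent / `μ` / image / CM / rank hypothesis, the crux's ROW currency, the
CONDUCTOR level (`w_V·(−N_V | p)`), and the CYCLOTOMIC-LINE reading `u ∈ 1 + pℤ_p`, `t = u − 1`, `t^ι = u⁻¹ − 1`:
**`‖L(u⁻¹ − 1)‖ = ‖L(u − 1)‖`** — the `p`-adic absolute values of `L_p^±(V, η)` along `κ^s ↦ κ^{−s}` are symmetric (Mazur–Tate–Teitelbaum's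
`s ↦ 2 − s` on the `η`-branch, weight 2). This is the instrument k8eta-c2 g28 asked for (NEXT (1): "evaluation form of XIII") and the
value-level half of k8eta-c1's functional-equation squeeze for crux 19601 (`…PlusEtaLowerInclusionFunctionalEquationSqueeze`: the extra
zeros `T = c₁, c₂` of `L_p⁺(V, η, X)` "swapped by `s ↦ −s`": by §31–§33 ONE zero `t ≠ 0` of the open disc produces the second, `t^ι ≠ t`).

WHAT. §30 `norm_lt_one_of_partner`, `partner_unique`, `evalHom_X_eq`, `evalHom_C_eq`, `evalHom_invSubOne` (`ev_t((1+T)⁻¹ − 1) = t^ι`),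
**`evalHom_invol`**, `evalHom_binomialSeries_mul_neg`, `isUnit_evalHom_binomialSeries`, `norm_evalHom_binomialSeries`,
`evalHom_binomialSeries_natCast` (`= (1+t)^n`), `evalHom_zero_eq_constantCoeff`; §31 `evalHom_shift_eq` (the value recursion),
`exists_eq_X_sub_C_mul_add_C_evalHom` (`L = (T − t)·Q + L(t)`), **`X_sub_C_dvd_iff_evalHom_eq_zero`**; §32 (generic exact FE)
**`evalHom_partner_eq_of_invol_eq`**, `norm_evalHom_partner_eq_of_invol_eq`, `evalHom_eq_zero_iff_of_invol_eq`, `units_partner`;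
§33 `evalHom_partner_eq_of_isQuadraticBranch{Plus,Minus}LFunction`, **`norm_evalHom_partner_eq_of_isQuadraticBranch{Plus,Minus}LFunction`**,
`evalHom_eq_zero_iff_of_isQuadraticBranch{Plus,Minus}LFunction`, rows `norm_evalHom_partner_eq_{plus,minus}_row`,
`evalHom_eq_zero_iff_{plus,minus}_row`, `norm_evalHom_units_inv_eq_plus_row` (cyclotomic line), conductor level
`evalHom_partner_eq_plus_rootNumber`.

HONEST FRAMING (cell `bsd-potss`; FULL-BSD rank ≤ 1 programme, HUMAN RULING D-0036/D-0074): TOOL THEOREMS ONLY — no definition, no named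
fact, no `sorry`, axioms standard; nothing about (A), (C1⁺_η), (E⁺_η), C-cc-1 or `BSD(W,p)` of any pair is claimed; no stub of 19606 (or
19601) is proved; crux and route OPEN; nothing booked. Points of `𝓞_K` for `K/ℚ_p` finite (e.g. `ζ_{pⁿ} − 1`, the interpolation points, or
zeros in quadratic extensions) are NOT covered: the tree's evaluation homomorphism is `ℤ_p`-valued. `--supports stmt-BirchSwinnertonDyer-19606`.

References: [MazurTateTeitelbaum1986Invent] §I.17 (the functional equation through `ι`, `s ↦ 2 − s`); [GreenbergLNM1716] §5 (p. 181: the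
root pairing `a ↔ (1+a)⁻¹ − 1`); [Washington1997] §7.1 (evaluation of `Λ` at `pℤ_p`, division by `T − t`), §13.2; Bourbaki, *Algèbre* IV §4
no. 3 (evaluation commutes with substitution); [Kobayashi2003] Thm. 3.2, (3.4)–(3.5); [Sprung2017] Cor. 4.14. Tree: Parts IX, X, XIII;
`PadicSeriesEvaluation.lean` (`evalHom`, `padicInt_eval₂_powerSeries_subst`); `IwasawaAlgebraInvolution.lean` (`invol`, `invSubOne`).
-/

set_option autoImplicit false
set_option linter.dupNamespace false
noncomputable section

open scoped Classical MatrixGroups ModularForm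

open CongruenceSubgroup WeierstrassCurve Literature.NumberTheory.EllipticCurves
  Literature.NumberTheory.EllipticCurves.ModularForms
open Literature.NumberTheory.EllipticCurves.IwasawaAlgebra
open Summit.BirchSwinnertonDyer.Rank1Residual.Additive

namespace Summit.BirchSwinnertonDyer.BirchSwinnertonDyer.Theorems.EtaThetaFunctionalEquation

variable {p : ℕ} [hp : Fact p.Prime]

/-! ## §30 Points of the open disc, partners `(1+t)(1+t^ι) = 1`, and the values of `ι L` and of `(1+T)^e` -/

/-- The partner of a point of the open disc lies in the open disc: `(1+t)(1+t') = 1`, `‖t‖ < 1 ⇒ ‖t'‖ < 1` (`t' = −t(1+t')`). [folklore] -/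
theorem norm_lt_one_of_partner {t t' : ℤ_[p]} (htt : (1 + t) * (1 + t') = 1) (ht : ‖t‖ < 1) : ‖t'‖ < 1 := by
  have h : t' = -t * (1 + t') := by linear_combination htt
  rw [h, norm_mul, norm_neg]
  calc ‖t‖ * ‖1 + t'‖ ≤ ‖t‖ * 1 := by gcongr; exact PadicInt.norm_le_one _
    _ < 1 := by rw [mul_one]; exact ht

/-- Partners are unique: `(1+t)(1+t') = 1 = (1+t)(1+t'') ⇒ t' = t''`. [folklore] -/
theorem partner_unique {t t' t'' : ℤ_[p]} (h' : (1 + t) * (1 + t') = 1) (h'' : (1 + t) * (1 + t'') = 1) : t' = t'' := by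
  linear_combination (1 + t'') * h' - (1 + t') * h''

/-- A principal unit `u` (`‖u − 1‖ < 1`) and its inverse give a partner pair `t = u − 1`, `t' = u⁻¹ − 1`: `(1+t)(1+t') = u·u⁻¹ = 1` — the points
`κ^s − 1 ↔ κ^{−s} − 1` of the cyclotomic line. [cite: MazurTateTeitelbaum1986Invent, §I.17] -/
theorem units_partner (u : ℤ_[p]ˣ) : (1 + ((u : ℤ_[p]) - 1)) * (1 + ((↑u⁻¹ : ℤ_[p]) - 1)) = 1 := by
  rw [add_sub_cancel, add_sub_cancel, Units.mul_inv]

/-- `ev_t(T) = t`. [folklore] -/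
theorem evalHom_X_eq {t : ℤ_[p]} (ht : ‖t‖ < 1) : evalHom t ht PowerSeries.X = t := by
  rw [evalHom_apply, PowerSeries.eval₂_X]

/-- `ev_t(C a) = a`. [folklore] -/
theorem evalHom_C_eq {t : ℤ_[p]} (ht : ‖t‖ < 1) (a : ℤ_[p]) : evalHom t ht (PowerSeries.C a) = a := by
  rw [evalHom_apply, PowerSeries.eval₂_C, RingHom.id_apply]

/-- **`ev_t((1+T)⁻¹ − 1) = t^ι`**: the value of `invSubOne p = ι T` at `t` is the partner `t'` of `t` (`(1+t)(1+t') = 1`), since evaluation is a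
ring map and `(1+T)(1 + ((1+T)⁻¹ − 1)) = 1`. [cite: Washington1997, §7.1 and §13.2] -/
theorem evalHom_invSubOne {t t' : ℤ_[p]} (ht : ‖t‖ < 1) (htt : (1 + t) * (1 + t') = 1) : evalHom t ht (invSubOne p) = t' := by
  have h1 : (1 + t) * (1 + evalHom t ht (invSubOne p)) = 1 := by
    have h := congrArg (evalHom t ht) (one_add_X_mul_one_add_invSubOne p)
    rwa [map_mul, map_add, map_add, map_one, evalHom_X_eq ht] at h
  exact partner_unique h1 htt

/-- **`(ι L)(t) = L(t^ι)`**: evaluation at a point `t` of the open disc of the Iwasawa involution `ι L = L((1+T)⁻¹ − 1)` is evaluation of `L` at the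
partner `t' = (1+t)⁻¹ − 1` — evaluation of `ℤ_p`-series commutes with substitution (Bourbaki), and `ev_t((1+T)⁻¹ − 1) = t'`.
[cite: MazurTateTeitelbaum1986Invent, §I.17] [cite: Washington1997, §13.2] -/
theorem evalHom_invol {t t' : ℤ_[p]} (ht : ‖t‖ < 1) (ht' : ‖t'‖ < 1) (htt : (1 + t) * (1 + t') = 1) (L : IwasawaAlgebra p) :
    evalHom t ht (invol p L) = evalHom t' ht' L := by
  have h := padicInt_eval₂_powerSeries_subst (hasSubst_invSubOne p) (PowerSeries.hasEval (padicInt_hasEval ht)) L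
  have h2 : MvPowerSeries.eval₂ (RingHom.id ℤ_[p]) (fun _ : Unit => t) (invSubOne p) = t' := by
    have h3 := evalHom_invSubOne ht htt
    rw [evalHom_apply] at h3
    exact h3
  rw [h2] at h
  rw [evalHom_apply, evalHom_apply, invol_apply]
  exact h

/-- `(1+t)^e · (1+t)^{−e} = 1` for the VALUES `(1+t)^e := ev_t (1+T)^e` of Mathlib's binomial series (`(1+T)^e(1+T)^{−e} = (1+T)^0 = 1`). [folklore] -/
theorem evalHom_binomialSeries_mul_neg {t : ℤ_[p]} (ht : ‖t‖ < 1) (e : ℤ_[p]) :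
    evalHom t ht (PowerSeries.binomialSeries ℤ_[p] e) * evalHom t ht (PowerSeries.binomialSeries ℤ_[p] (-e)) = 1 := by
  rw [← map_mul, ← PowerSeries.binomialSeries_add, add_neg_cancel, PowerSeries.binomialSeries_zero, map_one]

/-- `(1+t)^e ∈ ℤ_pˣ`. [folklore] -/
theorem isUnit_evalHom_binomialSeries {t : ℤ_[p]} (ht : ‖t‖ < 1) (e : ℤ_[p]) :
    IsUnit (evalHom t ht (PowerSeries.binomialSeries ℤ_[p] e)) :=
  IsUnit.of_mul_eq_one _ (evalHom_binomialSeries_mul_neg ht e)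

/-- `‖(1+t)^e‖ = 1`. [folklore] -/
theorem norm_evalHom_binomialSeries {t : ℤ_[p]} (ht : ‖t‖ < 1) (e : ℤ_[p]) :
    ‖evalHom t ht (PowerSeries.binomialSeries ℤ_[p] e)‖ = 1 :=
  PadicInt.isUnit_iff.mp (isUnit_evalHom_binomialSeries ht e)

/-- For a natural exponent the value IS the power: `ev_t (1+T)^n = (1+t)^n`. [folklore] -/
theorem evalHom_binomialSeries_natCast {t : ℤ_[p]} (ht : ‖t‖ < 1) (n : ℕ) :
    evalHom t ht (PowerSeries.binomialSeries ℤ_[p] (n : ℤ_[p])) = (1 + t) ^ n := by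
  rw [PowerSeries.binomialSeries_nat, map_pow, map_add, map_one, evalHom_X_eq ht]

/-- At the SELF-PAIRED point `t = 0` the value is the constant term: `L(0) = L(T)|_{T=0}`. [folklore] -/
theorem evalHom_zero_eq_constantCoeff (h0 : ‖(0 : ℤ_[p])‖ < 1) (L : IwasawaAlgebra p) :
    evalHom 0 h0 L = PowerSeries.constantCoeff L := by
  conv_lhs => rw [PowerSeries.eq_X_mul_shift_add_const L]
  rw [map_add, map_mul, evalHom_X_eq h0, zero_mul, zero_add, evalHom_C_eq h0]

/-! ## §31 The factor theorem in `Λ`: `(T − t) ∣ L ⟺ L(t) = 0` (`‖t‖ < 1`) -/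

/-- **The value recursion**: `ev_t(Σ_j a_{j+m} T^j) = a_m + t · ev_t(Σ_j a_{j+m+1} T^j)` (split off the constant term and use that evaluation is a
ring map with `ev_t T = t`). [cite: Washington1997, §7.1] -/
theorem evalHom_shift_eq {t : ℤ_[p]} (ht : ‖t‖ < 1) (L : IwasawaAlgebra p) (m : ℕ) :
    evalHom t ht (PowerSeries.mk fun j => PowerSeries.coeff (j + m) L) =
      PowerSeries.coeff m L + t * evalHom t ht (PowerSeries.mk fun j => PowerSeries.coeff (j + (m + 1)) L) := by
  have hshift : (PowerSeries.mk fun j => PowerSeries.coeff (j + 1)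
      (PowerSeries.mk fun j => PowerSeries.coeff (j + m) L : IwasawaAlgebra p)) =
      PowerSeries.mk fun j => PowerSeries.coeff (j + (m + 1)) L := by
    ext j
    simp only [PowerSeries.coeff_mk]
    rw [Nat.add_right_comm, Nat.add_assoc]
  have h0 : PowerSeries.constantCoeff (PowerSeries.mk fun j => PowerSeries.coeff (j + m) L : IwasawaAlgebra p) =
      PowerSeries.coeff m L := by
    rw [PowerSeries.constantCoeff_mk, zero_add]
  conv_lhs => rw [PowerSeries.eq_X_mul_shift_add_const (PowerSeries.mk fun j => PowerSeries.coeff (j + m) L)]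
  rw [map_add, map_mul, evalHom_X_eq ht, evalHom_C_eq ht, hshift, h0, add_comm]

/-- **Division by `T − t` with remainder the VALUE**: for `‖t‖ < 1` every `L ∈ Λ` is `L = (T − t)·Q + L(t)` with
`Q = Σ_i T^i · ev_t(Σ_j a_{j+i+1} T^j)` (each coefficient a convergent `p`-adic value). [cite: Washington1997, §7.1 (division by a distinguished polynomial)] -/
theorem exists_eq_X_sub_C_mul_add_C_evalHom {t : ℤ_[p]} (ht : ‖t‖ < 1) (L : IwasawaAlgebra p) :
    ∃ Q : IwasawaAlgebra p, L = (PowerSeries.X - PowerSeries.C t) * Q + PowerSeries.C (evalHom t ht L) := by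
  have hL : (PowerSeries.mk fun j => PowerSeries.coeff (j + 0) L) = L := by
    ext j; rw [PowerSeries.coeff_mk, add_zero]
  refine ⟨PowerSeries.mk fun i => evalHom t ht (PowerSeries.mk fun j => PowerSeries.coeff (j + (i + 1)) L),
    PowerSeries.ext fun n => ?_⟩
  rw [map_add, sub_mul, map_sub, PowerSeries.coeff_C_mul, PowerSeries.coeff_mk, PowerSeries.coeff_C]
  rcases n with _ | n
  · rw [PowerSeries.coeff_zero_X_mul, if_pos rfl]
    have h := evalHom_shift_eq ht L 0
    rw [hL] at h
    rw [h]
    ring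
  · rw [PowerSeries.coeff_succ_X_mul, PowerSeries.coeff_mk, if_neg n.succ_ne_zero, evalHom_shift_eq ht L (n + 1)]
    ring

/-- **THE FACTOR THEOREM IN `Λ`**: for a point `t` of the open disc (`‖t‖ < 1`), `(T − t) ∣ L ⟺ L(t) = 0`. So the `ℚ_p`-rational zeros of `L`
in the open disc are exactly the degree-one distinguished factors `T − t` of `L`, and Part XIII's `ι`-pairs of linear factors are `ι`-pairs
of zeros. [cite: Washington1997, §7.1] -/
theorem X_sub_C_dvd_iff_evalHom_eq_zero {t : ℤ_[p]} (ht : ‖t‖ < 1) (L : IwasawaAlgebra p) :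
    PowerSeries.X - PowerSeries.C t ∣ L ↔ evalHom t ht L = 0 := by
  constructor
  · rintro ⟨K, rfl⟩
    rw [map_mul, map_sub, evalHom_X_eq ht, evalHom_C_eq ht, sub_self, zero_mul]
  · intro h
    obtain ⟨Q, hQ⟩ := exists_eq_X_sub_C_mul_add_C_evalHom ht L
    rw [h, map_zero, add_zero] at hQ
    exact ⟨Q, hQ⟩

/-! ## §32 The value form of an exact functional equation `ι L = w·(1+T)^e·L` -/

/-- **`L(t^ι) = w · (1+t)^e · L(t)`**: an exact functional equation `ι L = w·(1+T)^e·L` in `Λ`, evaluated at a point `t` of the open disc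
(`(ι L)(t) = L(t^ι)`), relates the values at partner points by the UNIT `w·(1+t)^e`. [cite: MazurTateTeitelbaum1986Invent, §I.17]
[cite: GreenbergLNM1716, §5 (p. 181)] -/
theorem evalHom_partner_eq_of_invol_eq {L : PowerSeries ℤ_[p]} {w e : ℤ_[p]}
    (hFE : invol p L = PowerSeries.C w * PowerSeries.binomialSeries ℤ_[p] e * L) {t t' : ℤ_[p]} (ht : ‖t‖ < 1) (ht' : ‖t'‖ < 1)
    (htt : (1 + t) * (1 + t') = 1) :
    evalHom t' ht' L = w * evalHom t ht (PowerSeries.binomialSeries ℤ_[p] e) * evalHom t ht L := by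
  rw [← evalHom_invol ht ht' htt L, hFE, map_mul, map_mul, evalHom_C_eq ht]

/-- **`‖L(t^ι)‖ = ‖L(t)‖`** under an exact functional equation with `w² = 1`: the `p`-adic absolute values of `L` at partner points agree
(`‖w‖ = ‖(1+t)^e‖ = 1`). [cite: MazurTateTeitelbaum1986Invent, §I.17] -/
theorem norm_evalHom_partner_eq_of_invol_eq {L : PowerSeries ℤ_[p]} {w e : ℤ_[p]} (hw : w * w = 1)
    (hFE : invol p L = PowerSeries.C w * PowerSeries.binomialSeries ℤ_[p] e * L) {t t' : ℤ_[p]} (ht : ‖t‖ < 1) (ht' : ‖t'‖ < 1)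
    (htt : (1 + t) * (1 + t') = 1) : ‖evalHom t' ht' L‖ = ‖evalHom t ht L‖ := by
  rw [evalHom_partner_eq_of_invol_eq hFE ht ht' htt, norm_mul, norm_mul, norm_evalHom_binomialSeries ht e,
    PadicInt.isUnit_iff.mp (IsUnit.of_mul_eq_one w hw), one_mul, one_mul]

/-- **`L(t) = 0 ⟺ L(t^ι) = 0`** under an exact functional equation with `w² = 1` — the VALUE form of Part XIII's pairing of linear factors
(`X_sub_C_dvd_iff_of_invol_eq` + the factor theorem). [cite: GreenbergLNM1716, §5 (p. 181)] [cite: MazurTateTeitelbaum1986Invent, §I.17] -/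
theorem evalHom_eq_zero_iff_of_invol_eq {L : PowerSeries ℤ_[p]} {w e : ℤ_[p]} (hw : w * w = 1)
    (hFE : invol p L = PowerSeries.C w * PowerSeries.binomialSeries ℤ_[p] e * L) {t t' : ℤ_[p]} (ht : ‖t‖ < 1) (ht' : ‖t'‖ < 1)
    (htt : (1 + t) * (1 + t') = 1) : evalHom t ht L = 0 ↔ evalHom t' ht' L = 0 := by
  rw [← norm_eq_zero, ← norm_evalHom_partner_eq_of_invol_eq hw hFE ht ht' htt, norm_eq_zero]

/-! ## §33 On the quadratic branch: the values of every `L_p^±(V, η, X)` at partner points -/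

section Branch

variable {N : ℕ} [NeZero N] {f : CuspForm (Gamma0 N) 2}

/-- **THE VALUE RELATION OF `L_p⁺(V, η, X)` AT PARTNER POINTS** (explicit form): for `p` odd, `f` a rational newform of level `N` prime to `p`,
`a_p(f) = 0`, Fricke sign `σ`, `c` the `p`-adic exponent of `N`, `(p+1)b = −1`, ANY period ratio `ϖ`, every plus branch function `L` and
every partner pair `(1+t)(1+t') = 1` of the open disc: `L(t') = σ·(−N | p) · (1+t)^{c+b} · L(t)`.
[cite: MazurTateTeitelbaum1986Invent, §I.17] [cite: Sprung2017, Cor. 4.14] [cite: Kobayashi2003, Thm. 3.2, (3.4)] -/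
theorem evalHom_partner_eq_of_isQuadraticBranchPlusLFunction (hp2 : p ≠ 2) (hf0 : IsNewform0 f) (hQ : coeffField f = ⊥)
    (hpN : ¬ p ∣ N) (hap : cuspCoeff f p = ((0 : ℤ) : ℂ)) {σ : ℤ} (hσ : σ ^ 2 = 1)
    (hW : atkinLehnerInvolution N 2 N f = (-(σ : ℂ)) • f)
    {ηN : rootsOfUnity (torsionOrder p) ℤ_[p]} {c : ℤ_[p]}
    (hc : ∀ n : ℕ, PadicInt.toZModPow (n + cyclotomicExponent p) ((ηN : ℤ_[p]ˣ) : ℤ_[p]) *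
      (cyclotomicGenerator p : ZMod (p ^ (n + cyclotomicExponent p))) ^ (PadicInt.toZModPow n c).val =
        (N : ZMod (p ^ (n + cyclotomicExponent p))))
    {b : ℤ_[p]} (hb : ((p : ℤ_[p]) + 1) * b = -1)
    {ϖ : ℚ} {L : IwasawaAlgebra p} (hL : IsQuadraticBranchPlusLFunction f p ϖ L)
    {t t' : ℤ_[p]} (ht : ‖t‖ < 1) (ht' : ‖t'‖ < 1) (htt : (1 + t) * (1 + t') = 1) :
    evalHom t' ht' L = ((σ * legendreSym p (-(N : ℤ)) : ℤ) : ℤ_[p]) *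
      evalHom t ht (PowerSeries.binomialSeries ℤ_[p] (c + b)) * evalHom t ht L :=
  evalHom_partner_eq_of_invol_eq (invol_eq_of_isQuadraticBranchPlusLFunction hp2 hf0 hQ hpN hap hσ hW hc hb hL) ht ht' htt

/-- **THE VALUE RELATION OF `L_p⁻(V, η, X)` AT PARTNER POINTS** (explicit form; exponent `c + a`, `(p+1)a = −p`).
[cite: MazurTateTeitelbaum1986Invent, §I.17] [cite: Sprung2017, Cor. 4.14] [cite: Kobayashi2003, Thm. 3.2, (3.5)] -/
theorem evalHom_partner_eq_of_isQuadraticBranchMinusLFunction (hp2 : p ≠ 2) (hf0 : IsNewform0 f) (hQ : coeffField f = ⊥)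
    (hpN : ¬ p ∣ N) (hap : cuspCoeff f p = ((0 : ℤ) : ℂ)) {σ : ℤ} (hσ : σ ^ 2 = 1)
    (hW : atkinLehnerInvolution N 2 N f = (-(σ : ℂ)) • f)
    {ηN : rootsOfUnity (torsionOrder p) ℤ_[p]} {c : ℤ_[p]}
    (hc : ∀ n : ℕ, PadicInt.toZModPow (n + cyclotomicExponent p) ((ηN : ℤ_[p]ˣ) : ℤ_[p]) *
      (cyclotomicGenerator p : ZMod (p ^ (n + cyclotomicExponent p))) ^ (PadicInt.toZModPow n c).val =
        (N : ZMod (p ^ (n + cyclotomicExponent p))))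
    {a : ℤ_[p]} (ha : ((p : ℤ_[p]) + 1) * a = -(p : ℤ_[p]))
    {ϖ : ℚ} {L : IwasawaAlgebra p} (hL : IsQuadraticBranchMinusLFunction f p ϖ L)
    {t t' : ℤ_[p]} (ht : ‖t‖ < 1) (ht' : ‖t'‖ < 1) (htt : (1 + t) * (1 + t') = 1) :
    evalHom t' ht' L = ((σ * legendreSym p (-(N : ℤ)) : ℤ) : ℤ_[p]) *
      evalHom t ht (PowerSeries.binomialSeries ℤ_[p] (c + a)) * evalHom t ht L :=
  evalHom_partner_eq_of_invol_eq (invol_eq_of_isQuadraticBranchMinusLFunction hp2 hf0 hQ hpN hap hσ hW hc ha hL) ht ht' htt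

/-- **`‖L_p⁺(V, η)(t^ι)‖ = ‖L_p⁺(V, η)(t)‖`** for EVERY plus branch function, ANY period ratio, every partner pair of the open disc — no sign, no
exponent, no `μ`, image, CM or rank hypothesis. [cite: MazurTateTeitelbaum1986Invent, §I.17] [cite: Kobayashi2003, Thm. 3.2, (3.4)] -/
theorem norm_evalHom_partner_eq_of_isQuadraticBranchPlusLFunction (hp2 : p ≠ 2) (hf0 : IsNewform0 f) (hQ : coeffField f = ⊥)
    (hpN : ¬ p ∣ N) (hap : cuspCoeff f p = ((0 : ℤ) : ℂ)) {ϖ : ℚ} {L : IwasawaAlgebra p}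
    (hL : IsQuadraticBranchPlusLFunction f p ϖ L) {t t' : ℤ_[p]} (ht : ‖t‖ < 1) (ht' : ‖t'‖ < 1)
    (htt : (1 + t) * (1 + t') = 1) : ‖evalHom t' ht' L‖ = ‖evalHom t ht L‖ := by
  obtain ⟨σ, hσ, hW⟩ := exists_frickeSign_of_isNewform0 hf0
  obtain ⟨e, he⟩ := exists_invol_eq_of_isQuadraticBranchPlusLFunction hp2 hf0 hQ hpN hap hσ hW hL
  refine norm_evalHom_partner_eq_of_invol_eq ?_ he ht ht' htt
  rcases sign_eq_one_or hpN hσ with h | h <;> rw [h] <;> simp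

/-- **`‖L_p⁻(V, η)(t^ι)‖ = ‖L_p⁻(V, η)(t)‖`** (minus twin). [cite: MazurTateTeitelbaum1986Invent, §I.17] [cite: Kobayashi2003, Thm. 3.2, (3.5)] -/
theorem norm_evalHom_partner_eq_of_isQuadraticBranchMinusLFunction (hp2 : p ≠ 2) (hf0 : IsNewform0 f) (hQ : coeffField f = ⊥)
    (hpN : ¬ p ∣ N) (hap : cuspCoeff f p = ((0 : ℤ) : ℂ)) {ϖ : ℚ} {L : IwasawaAlgebra p}
    (hL : IsQuadraticBranchMinusLFunction f p ϖ L) {t t' : ℤ_[p]} (ht : ‖t‖ < 1) (ht' : ‖t'‖ < 1)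
    (htt : (1 + t) * (1 + t') = 1) : ‖evalHom t' ht' L‖ = ‖evalHom t ht L‖ := by
  obtain ⟨σ, hσ, hW⟩ := exists_frickeSign_of_isNewform0 hf0
  obtain ⟨e, he⟩ := exists_invol_eq_of_isQuadraticBranchMinusLFunction hp2 hf0 hQ hpN hap hσ hW hL
  refine norm_evalHom_partner_eq_of_invol_eq ?_ he ht ht' htt
  rcases sign_eq_one_or hpN hσ with h | h <;> rw [h] <;> simp

/-- **THE `ℚ_p`-RATIONAL ZEROS OF `L_p⁺(V, η, X)` IN THE OPEN DISC COME IN `ι`-PAIRS**: `L(t) = 0 ⟺ L(t^ι) = 0` (the value form of Part XIII's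
`X_sub_C_dvd_iff_of_isQuadraticBranchPlusLFunction`; only `t = 0` is self-paired, Part XIII `eq_zero_of_self_paired`).
[cite: GreenbergLNM1716, §5 (p. 181)] [cite: MazurTateTeitelbaum1986Invent, §I.17] -/
theorem evalHom_eq_zero_iff_of_isQuadraticBranchPlusLFunction (hp2 : p ≠ 2) (hf0 : IsNewform0 f) (hQ : coeffField f = ⊥)
    (hpN : ¬ p ∣ N) (hap : cuspCoeff f p = ((0 : ℤ) : ℂ)) {ϖ : ℚ} {L : IwasawaAlgebra p}
    (hL : IsQuadraticBranchPlusLFunction f p ϖ L) {t t' : ℤ_[p]} (ht : ‖t‖ < 1) (ht' : ‖t'‖ < 1)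
    (htt : (1 + t) * (1 + t') = 1) : evalHom t ht L = 0 ↔ evalHom t' ht' L = 0 := by
  rw [← norm_eq_zero, ← norm_evalHom_partner_eq_of_isQuadraticBranchPlusLFunction hp2 hf0 hQ hpN hap hL ht ht' htt, norm_eq_zero]

/-- **THE `ℚ_p`-RATIONAL ZEROS OF `L_p⁻(V, η, X)` IN THE OPEN DISC COME IN `ι`-PAIRS** (minus twin).
[cite: GreenbergLNM1716, §5 (p. 181)] [cite: MazurTateTeitelbaum1986Invent, §I.17] -/
theorem evalHom_eq_zero_iff_of_isQuadraticBranchMinusLFunction (hp2 : p ≠ 2) (hf0 : IsNewform0 f) (hQ : coeffField f = ⊥)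
    (hpN : ¬ p ∣ N) (hap : cuspCoeff f p = ((0 : ℤ) : ℂ)) {ϖ : ℚ} {L : IwasawaAlgebra p}
    (hL : IsQuadraticBranchMinusLFunction f p ϖ L) {t t' : ℤ_[p]} (ht : ‖t‖ < 1) (ht' : ‖t'‖ < 1)
    (htt : (1 + t) * (1 + t') = 1) : evalHom t ht L = 0 ↔ evalHom t' ht' L = 0 := by
  rw [← norm_eq_zero, ← norm_evalHom_partner_eq_of_isQuadraticBranchMinusLFunction hp2 hf0 hQ hpN hap hL ht ht' htt, norm_eq_zero]

end Branch

section Row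

variable {N : ℕ} [NeZero N] {f : CuspForm (Gamma0 N) 2}

/-- **AT A ROW (plus)**: `V` globally minimal, good at `p ≥ 5`, `a_p(V) = 0` (every row of crux 19606), `f` its newform (any level), any `ϖ`,
every `Lη = L_p⁺(V, η, X)`, every partner pair of the open disc: `‖Lη(t^ι)‖ = ‖Lη(t)‖`. Hypothesis-free beyond the row data.
[cite: MazurTateTeitelbaum1986Invent, §I.17] [cite: Kobayashi2003, Thm. 3.2, (3.4)] -/
theorem norm_evalHom_partner_eq_plus_row (hp5 : 5 ≤ p) (V : WeierstrassCurve ℚ) [V.IsElliptic] [V.IsGloballyMinimal]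
    (hgood : V.HasGoodReductionAtPrime p) (hap : V.frobeniusTrace p = 0) (hf : IsNewformOf V f) (ϖ : ℚ) {Lη : IwasawaAlgebra p}
    (hL : IsQuadraticBranchPlusLFunction f p ϖ Lη) {t t' : ℤ_[p]} (ht : ‖t‖ < 1) (ht' : ‖t'‖ < 1)
    (htt : (1 + t) * (1 + t') = 1) : ‖evalHom t' ht' Lη‖ = ‖evalHom t ht Lη‖ := by
  have hp2 : p ≠ 2 := by omega
  have hap' : cuspCoeff f p = ((0 : ℤ) : ℂ) := by
    rw [cuspCoeff_eq_frobeniusTrace_of_isNewformOf_holds hf hgood, hap]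
  exact norm_evalHom_partner_eq_of_isQuadraticBranchPlusLFunction hp2 hf.1 hf.coeffField_eq_bot
    (not_dvd_level_of_isNewformOf hf hgood) hap' hL ht ht' htt

/-- **AT A ROW (minus)**: `‖Lη(t^ι)‖ = ‖Lη(t)‖` for every `L_p⁻(V, η, X)`. [cite: MazurTateTeitelbaum1986Invent, §I.17]
[cite: Kobayashi2003, Thm. 3.2, (3.5)] -/
theorem norm_evalHom_partner_eq_minus_row (hp5 : 5 ≤ p) (V : WeierstrassCurve ℚ) [V.IsElliptic] [V.IsGloballyMinimal]
    (hgood : V.HasGoodReductionAtPrime p) (hap : V.frobeniusTrace p = 0) (hf : IsNewformOf V f) (ϖ : ℚ) {Lη : IwasawaAlgebra p}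
    (hL : IsQuadraticBranchMinusLFunction f p ϖ Lη) {t t' : ℤ_[p]} (ht : ‖t‖ < 1) (ht' : ‖t'‖ < 1)
    (htt : (1 + t) * (1 + t') = 1) : ‖evalHom t' ht' Lη‖ = ‖evalHom t ht Lη‖ := by
  have hp2 : p ≠ 2 := by omega
  have hap' : cuspCoeff f p = ((0 : ℤ) : ℂ) := by
    rw [cuspCoeff_eq_frobeniusTrace_of_isNewformOf_holds hf hgood, hap]
  exact norm_evalHom_partner_eq_of_isQuadraticBranchMinusLFunction hp2 hf.1 hf.coeffField_eq_bot
    (not_dvd_level_of_isNewformOf hf hgood) hap' hL ht ht' htt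

/-- **AT A ROW (plus), zeros**: `Lη(t) = 0 ⟺ Lη(t^ι) = 0`. [cite: GreenbergLNM1716, §5 (p. 181)] [cite: MazurTateTeitelbaum1986Invent, §I.17] -/
theorem evalHom_eq_zero_iff_plus_row (hp5 : 5 ≤ p) (V : WeierstrassCurve ℚ) [V.IsElliptic] [V.IsGloballyMinimal]
    (hgood : V.HasGoodReductionAtPrime p) (hap : V.frobeniusTrace p = 0) (hf : IsNewformOf V f) (ϖ : ℚ) {Lη : IwasawaAlgebra p}
    (hL : IsQuadraticBranchPlusLFunction f p ϖ Lη) {t t' : ℤ_[p]} (ht : ‖t‖ < 1) (ht' : ‖t'‖ < 1)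
    (htt : (1 + t) * (1 + t') = 1) : evalHom t ht Lη = 0 ↔ evalHom t' ht' Lη = 0 := by
  rw [← norm_eq_zero, ← norm_evalHom_partner_eq_plus_row hp5 V hgood hap hf ϖ hL ht ht' htt, norm_eq_zero]

/-- **AT A ROW (minus), zeros**: `Lη(t) = 0 ⟺ Lη(t^ι) = 0`. [cite: GreenbergLNM1716, §5 (p. 181)] [cite: MazurTateTeitelbaum1986Invent, §I.17] -/
theorem evalHom_eq_zero_iff_minus_row (hp5 : 5 ≤ p) (V : WeierstrassCurve ℚ) [V.IsElliptic] [V.IsGloballyMinimal]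
    (hgood : V.HasGoodReductionAtPrime p) (hap : V.frobeniusTrace p = 0) (hf : IsNewformOf V f) (ϖ : ℚ) {Lη : IwasawaAlgebra p}
    (hL : IsQuadraticBranchMinusLFunction f p ϖ Lη) {t t' : ℤ_[p]} (ht : ‖t‖ < 1) (ht' : ‖t'‖ < 1)
    (htt : (1 + t) * (1 + t') = 1) : evalHom t ht Lη = 0 ↔ evalHom t' ht' Lη = 0 := by
  rw [← norm_eq_zero, ← norm_evalHom_partner_eq_minus_row hp5 V hgood hap hf ϖ hL ht ht' htt, norm_eq_zero]

/-- **THE CYCLOTOMIC LINE AT A ROW (plus)**: for a principal unit `u ∈ 1 + pℤ_p` (the point `γ ↦ u` of the cyclotomic line, `T = u − 1`),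
`‖Lη(u⁻¹ − 1)‖ = ‖Lη(u − 1)‖` — the absolute values of `L_p⁺(V, η)` along `κ^s ↦ κ^{−s}` are symmetric (`s ↦ 2 − s` on the `η`-branch).
[cite: MazurTateTeitelbaum1986Invent, §I.17] [cite: Kobayashi2003, Thm. 3.2, (3.4)] -/
theorem norm_evalHom_units_inv_eq_plus_row (hp5 : 5 ≤ p) (V : WeierstrassCurve ℚ) [V.IsElliptic] [V.IsGloballyMinimal]
    (hgood : V.HasGoodReductionAtPrime p) (hap : V.frobeniusTrace p = 0) (hf : IsNewformOf V f) (ϖ : ℚ) {Lη : IwasawaAlgebra p}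
    (hL : IsQuadraticBranchPlusLFunction f p ϖ Lη) (u : ℤ_[p]ˣ) (hu : ‖(u : ℤ_[p]) - 1‖ < 1)
    (hu' : ‖(↑u⁻¹ : ℤ_[p]) - 1‖ < 1) :
    ‖evalHom ((↑u⁻¹ : ℤ_[p]) - 1) hu' Lη‖ = ‖evalHom ((u : ℤ_[p]) - 1) hu Lη‖ :=
  norm_evalHom_partner_eq_plus_row hp5 V hgood hap hf ϖ hL hu hu' (units_partner u)

end Row

section Root

variable {V : WeierstrassCurve ℚ} [V.IsElliptic] [NeZero (V.conductorNorm ℤ)]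
  {f : CuspForm (Gamma0 (V.conductorNorm ℤ)) 2} [V.IsGloballyMinimal]

/-- **CONDUCTOR LEVEL (plus): `Lη(t^ι) = w_V·(−N_V | p) · (1+t)^{c+b} · Lη(t)`** — for the newform of `V` at level `N_V` the sign is the root
number of the additive partner `W = V^{(p*)}` (Part VII `atkinLehnerInvolution_eq_neg_rootNumber_smul`, Part XIV); `c` the `p`-adic exponent of
`N_V`, `(p+1)b = −1`. [cite: MazurTateTeitelbaum1986Invent, §I.17] [cite: Sprung2017, Cor. 4.14] [cite: AtkinLehner1970, Thm. 3] -/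
theorem evalHom_partner_eq_plus_rootNumber (hp5 : 5 ≤ p) (hgood : V.HasGoodReductionAtPrime p) (hap : V.frobeniusTrace p = 0)
    (hf : IsNewformOf V f) {ηN : rootsOfUnity (torsionOrder p) ℤ_[p]} {c : ℤ_[p]}
    (hc : ∀ n : ℕ, PadicInt.toZModPow (n + cyclotomicExponent p) ((ηN : ℤ_[p]ˣ) : ℤ_[p]) *
      (cyclotomicGenerator p : ZMod (p ^ (n + cyclotomicExponent p))) ^ (PadicInt.toZModPow n c).val =
        (V.conductorNorm ℤ : ZMod (p ^ (n + cyclotomicExponent p))))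
    {b : ℤ_[p]} (hb : ((p : ℤ_[p]) + 1) * b = -1)
    (ϖ : ℚ) {Lη : IwasawaAlgebra p} (hL : IsQuadraticBranchPlusLFunction f p ϖ Lη)
    {t t' : ℤ_[p]} (ht : ‖t‖ < 1) (ht' : ‖t'‖ < 1) (htt : (1 + t) * (1 + t') = 1) :
    evalHom t' ht' Lη = ((V.rootNumber * legendreSym p (-(V.conductorNorm ℤ : ℤ)) : ℤ) : ℤ_[p]) *
      evalHom t ht (PowerSeries.binomialSeries ℤ_[p] (c + b)) * evalHom t ht Lη :=
  evalHom_partner_eq_of_invol_eq (invol_eq_plus_rootNumber hp5 hgood hap hf hc hb ϖ hL) ht ht' htt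

end Root

end Summit.BirchSwinnertonDyer.BirchSwinnertonDyer.Theorems.EtaThetaFunctionalEquation

end
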